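import Summits.ValiantsHypothesis.ValiantsHypothesis.Theorems.KPlusLogSqLawTropicalBIntervalOptDefs

/-!
# Route «KPlusLogSqLaw», crux `TropicalB` (stmt-ValiantsHypothesis-19771) — restricted optima of a design on a column set:
# the Gusfield divide-and-conquer toolkit (sub-additivity of optimal restrictions under union)

HONEST FRAMING.  Helper file toward the registered stubs `stub_tropThin` / `stub_tropFat` of
`Cruxes/TropicalB/Lines/birth.lean` (crux `TropicalB`, item stmt-ValiantsHypothesis-19771, route KPlusLogSqLaw, DRAFT; seat
val-sym-trop-p5, desk docket D1(b) «first TropicalB rung beyond slope counting» = the HESSENBERG sector theorem of the sibling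
file `KPlusLogSqLawTropicalBHessenberg.lean`).  Nothing here proves any part of a stub; nothing asserts `TropicalB`,
`KPlusLogSqLaw`, `MatrixDescartes` (stmt-ValiantsHypothesis-18050) or anything about VP ≠ VNP.

THE TOOLKIT (all [folklore]; Gusfield 1980's argument for parametric shortest paths, phrased for Leibniz terms of a tropical
design `(d, v, ε)` of format `(m, K)`; objects in `KPlusLogSqLawTropicalBIntervalOptDefs.lean`):
* `restr_eq_iff`, `eq_of_restr_eq_of_agreeOut`, `inW_congr`, `inW_union`, `tropWeight_eq_inW_univ`, `slr_restr`,
  `mem_optRestr` — bookkeeping;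
* `inOpt_mono` — OPTIMAL SUBSTRUCTURE: a restricted optimum on `J` is one on every `J' ⊆ J`; `inOpt_univ_of_isDominant`;
* `exists_glue` — if two permutations map `J` onto the same set, one term's `J`-part glues onto the other's complement;
  hence the KEY COMPARISON `sl_lt_of_inOpt` / `restr_eq_of_inOpt` / `sl_le_of_inOpt`: restricted optima on `J` at slopes
  `θ₁ < θ₂` (same image of `J`) coincide on `J` or have strictly increasing `J`-slope; at equal slope they coincide;
* `card_chain_le` — a chain inside `A × B ⊆ ℤ × ℤ` has at most `#A + #B` elements (rank-sum injection);
* `card_optRestr_union_le` — SUB-ADDITIVITY: `#optRestr (J₁ ∪ J₂) Q ≤ #optRestr J₁ Q₁ + #optRestr J₂ Q₂` whenever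
  `Q ⇒ Q₁ ∧ Q₂` and `Q₁` (resp. `Q₂`) fixes the image of `J₁` (resp. `J₂`) under the permutation (the restrictions on
  `J₁ ∪ J₂`, read through their two slopes, form a chain in `ℤ × ℤ`);
(Atoms and the top of the recursion are in the sibling file `KPlusLogSqLawTropicalBHessenberg.lean`.)
-/

set_option linter.dupNamespace false
set_option autoImplicit false

namespace Summit.ValiantsHypothesis.ValiantsHypothesis.Theorems.KPlusLogSqLaw

open Summit.ValiantsHypothesis.ValiantsHypothesis.Theorems.MatrixDescartes.Negative
open Summit.ValiantsHypothesis.ValiantsHypothesis.Theorems.LacunarySymmetroidMatrixDescartes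
open scoped BigOperators
open Finset

namespace IntervalOpt

variable {m K : ℕ} {d : Fin K → ℕ} {v ε : Fin m → Fin m → Fin K → ℤ}

/-! ## 1. Bookkeeping -/

/-- the restriction stores `(σ i, λ i)` at a column of `J`. [folklore] -/
theorem restr_apply_of_mem {J : Finset (Fin m)} {p : Equiv.Perm (Fin m) × (Fin m → Fin K)} {i : Fin m} (h : i ∈ J) :
    restr J p i = some (p.1 i, p.2 i) := if_pos h

/-- the restriction stores nothing off `J`. [folklore] -/
theorem restr_apply_of_not_mem {J : Finset (Fin m)} {p : Equiv.Perm (Fin m) × (Fin m → Fin K)} {i : Fin m}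
    (h : i ∉ J) : restr J p i = none := if_neg h

/-- two terms have the same restriction to `J` iff they agree on the columns of `J`. [folklore] -/
theorem restr_eq_iff {J : Finset (Fin m)} {p p' : Equiv.Perm (Fin m) × (Fin m → Fin K)} :
    restr J p = restr J p' ↔ ∀ i ∈ J, p.1 i = p'.1 i ∧ p.2 i = p'.2 i := by
  constructor
  · intro h i hi
    have h1 := congrFun h i
    rw [restr_apply_of_mem hi, restr_apply_of_mem hi, Option.some.injEq, Prod.mk.injEq] at h1
    exact h1
  · intro h
    funext i
    by_cases hi : i ∈ J
    · rw [restr_apply_of_mem hi, restr_apply_of_mem hi, (h i hi).1, (h i hi).2]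
    · rw [restr_apply_of_not_mem hi, restr_apply_of_not_mem hi]

/-- restrictions to a smaller column set agree if the larger ones do. [folklore] -/
theorem restr_mono {J J' : Finset (Fin m)} (hJ : J' ⊆ J) {p p' : Equiv.Perm (Fin m) × (Fin m → Fin K)}
    (h : restr J p = restr J p') : restr J' p = restr J' p' :=
  restr_eq_iff.2 fun i hi => restr_eq_iff.1 h i (hJ hi)

/-- a term is determined by its restriction to `J` and its data off `J`. [folklore] -/
theorem eq_of_restr_eq_of_agreeOut {J : Finset (Fin m)} {p p' : Equiv.Perm (Fin m) × (Fin m → Fin K)}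
    (h : restr J p = restr J p') (ho : AgreeOut J p p') : p = p' := by
  have h1 := restr_eq_iff.1 h
  refine Prod.ext (Equiv.ext fun i => ?_) (funext fun i => ?_)
  · by_cases hi : i ∈ J
    · exact (h1 i hi).1
    · exact (ho i hi).1
  · by_cases hi : i ∈ J
    · exact (h1 i hi).2
    · exact (ho i hi).2

/-- the `J`-slope only depends on the restriction to `J`. [folklore] -/
theorem sl_congr {J : Finset (Fin m)} {p p' : Equiv.Perm (Fin m) × (Fin m → Fin K)} (h : restr J p = restr J p') :
    sl d J p = sl d J p' :=
  Finset.sum_congr rfl fun i hi => by rw [(restr_eq_iff.1 h i hi).2]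

/-- the `J`-valuation only depends on the restriction to `J`. [folklore] -/
theorem cst_congr {J : Finset (Fin m)} {p p' : Equiv.Perm (Fin m) × (Fin m → Fin K)} (h : restr J p = restr J p') :
    cst v J p = cst v J p' :=
  Finset.sum_congr rfl fun i hi => by
    obtain ⟨h1, h2⟩ := restr_eq_iff.1 h i hi
    rw [h1, h2]

/-- the `J`-weight only depends on the restriction to `J`. [folklore] -/
theorem inW_congr {J : Finset (Fin m)} {p p' : Equiv.Perm (Fin m) × (Fin m → Fin K)} (h : restr J p = restr J p')
    (θ : ℤ) : inW d v J θ p = inW d v J θ p' := by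
  unfold inW; rw [sl_congr h, cst_congr h]

/-- the `J`-weight is additive over disjoint column sets. [folklore] -/
theorem inW_union {J₁ J₂ : Finset (Fin m)} (h : Disjoint J₁ J₂) (θ : ℤ) (p : Equiv.Perm (Fin m) × (Fin m → Fin K)) :
    inW d v (J₁ ∪ J₂) θ p = inW d v J₁ θ p + inW d v J₂ θ p := by
  unfold inW sl cst
  rw [Finset.sum_union h, Finset.sum_union h]
  ring

/-- the tropical weight is the weight carried by all columns. [folklore] -/
theorem tropWeight_eq_inW_univ (θ : ℤ) (p : Equiv.Perm (Fin m) × (Fin m → Fin K)) :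
    tropWeight d v θ p = inW d v Finset.univ θ p := rfl

/-- slope read off a restriction is the slope. [folklore] -/
theorem slr_restr {J J' : Finset (Fin m)} (hJ : J' ⊆ J) (p : Equiv.Perm (Fin m) × (Fin m → Fin K)) :
    slr d J' (restr J p) = sl d J' p := by
  unfold slr sl
  refine Finset.sum_congr rfl fun i hi => ?_
  rw [restr_apply_of_mem (hJ hi)]
  rfl

open Classical in
/-- membership in `optRestr`. [folklore] -/
theorem mem_optRestr {J : Finset (Fin m)} {Q : Equiv.Perm (Fin m) × (Fin m → Fin K) → Prop}
    {r : Fin m → Option (Fin m × Fin K)} :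
    r ∈ optRestr d v ε J Q ↔ ∃ p θ, Q p ∧ InOpt d v ε J θ p ∧ restr J p = r := by
  unfold optRestr
  simp only [Finset.mem_filter, Finset.mem_univ, true_and]

/-! ## 2. Optimal substructure and the top -/

/-- **Optimal substructure**: a restricted optimum on `J` is a restricted optimum on every `J' ⊆ J`. [folklore] -/
theorem inOpt_mono {J J' : Finset (Fin m)} (hJ : J' ⊆ J) {θ : ℤ} {p : Equiv.Perm (Fin m) × (Fin m → Fin K)}
    (h : InOpt d v ε J θ p) : InOpt d v ε J' θ p := by
  refine ⟨h.1, fun p' hne hp' hag => ?_⟩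
  have hag' : AgreeOut J p p' := fun i hi => hag i fun hi' => hi (hJ hi')
  have hlt := h.2 p' hne hp' hag'
  have hsplit : ∀ q : Equiv.Perm (Fin m) × (Fin m → Fin K), inW d v J θ q = inW d v J' θ q + inW d v (J \ J') θ q := by
    intro q
    rw [← inW_union Finset.disjoint_sdiff θ q, Finset.union_sdiff_of_subset hJ]
  have hrest : inW d v (J \ J') θ p' = inW d v (J \ J') θ p := by
    apply inW_congr
    refine restr_eq_iff.2 fun i hi => ?_
    rw [Finset.mem_sdiff] at hi
    obtain ⟨h1, h2⟩ := hag i hi.2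
    exact ⟨h1.symm, h2.symm⟩
  rw [hsplit p', hsplit p, hrest] at hlt
  linarith

/-- a dominant term is a restricted optimum on the full column set. [folklore] -/
theorem inOpt_univ_of_isDominant {θ : ℤ} {p : Equiv.Perm (Fin m) × (Fin m → Fin K)} (h : IsDominant d v ε θ p) :
    InOpt d v ε Finset.univ θ p :=
  ⟨h.1, fun p' hne hp' _ => by
    have h2 := h.2 p' hne hp'
    rwa [tropWeight_eq_inW_univ, tropWeight_eq_inW_univ] at h2⟩

/-! ## 3. Gluing and the key comparison -/

/-- **Glue.**  If the permutations of `p₁` and `p₂` map `J` onto the same set, there is a term equal to `p₂` on `J` and to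
`p₁` off `J`. [folklore] -/
theorem exists_glue (J : Finset (Fin m)) (p₁ p₂ : Equiv.Perm (Fin m) × (Fin m → Fin K))
    (himg : J.image p₁.1 = J.image p₂.1) :
    ∃ q : Equiv.Perm (Fin m) × (Fin m → Fin K), restr J q = restr J p₂ ∧ AgreeOut J p₁ q := by
  classical
  let g : Fin m → Fin m := fun i => if i ∈ J then p₂.1 i else p₁.1 i
  have hcross : ∀ i i', i ∈ J → i' ∉ J → p₂.1 i ≠ p₁.1 i' := by
    intro i i' hi hi' h
    have hmem : p₂.1 i ∈ J.image p₁.1 := himg ▸ Finset.mem_image_of_mem _ hi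
    obtain ⟨j, hj, hj'⟩ := Finset.mem_image.1 hmem
    rw [h] at hj'
    exact hi' (p₁.1.injective hj' ▸ hj)
  have hg : Function.Injective g := by
    intro i i' h
    by_cases hi : i ∈ J <;> by_cases hi' : i' ∈ J <;> simp only [g, hi, hi', if_true, if_false] at h
    · exact p₂.1.injective h
    · exact absurd h (hcross i i' hi hi')
    · exact absurd h.symm (hcross i' i hi' hi)
    · exact p₁.1.injective h
  have hbij : Function.Bijective g := Finite.injective_iff_bijective.mp hg
  refine ⟨(Equiv.ofBijective g hbij, fun i => if i ∈ J then p₂.2 i else p₁.2 i), ?_, ?_⟩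
  · refine restr_eq_iff.2 fun i hi => ?_
    simp only [Equiv.ofBijective_apply, g, hi, if_true, and_self]
  · intro i hi
    simp only [Equiv.ofBijective_apply, g, hi, if_false, and_self]

/-- a restricted optimum on `J` beats, on `J`, every present term whose permutation maps `J` onto the same set and whose
restriction to `J` differs (glue that restriction onto the optimum's complement). [folklore] -/
theorem inW_lt_of_inOpt {J : Finset (Fin m)} {θ : ℤ} {p₁ p₂ : Equiv.Perm (Fin m) × (Fin m → Fin K)}
    (h1 : InOpt d v ε J θ p₁) (hp₂ : termSign ε p₂ ≠ 0) (himg : J.image p₁.1 = J.image p₂.1)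
    (hne : restr J p₁ ≠ restr J p₂) : inW d v J θ p₂ < inW d v J θ p₁ := by
  obtain ⟨q, hq, hag⟩ := exists_glue J p₁ p₂ himg
  have hqne : q ≠ p₁ := fun h => hne (by rw [← hq, h])
  have hqpres : termSign ε q ≠ 0 := by
    rw [termSign_ne_zero_iff] at hp₂ ⊢
    have h1p := (termSign_ne_zero_iff ε p₁).1 h1.1
    intro i
    by_cases hi : i ∈ J
    · obtain ⟨e1, e2⟩ := restr_eq_iff.1 hq i hi
      rw [e1, e2]
      exact hp₂ i
    · obtain ⟨e1, e2⟩ := hag i hi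
      rw [← e1, ← e2]
      exact h1p i
  have hlt := h1.2 q hqne hqpres hag
  rwa [inW_congr hq] at hlt

/-- **Slopes increase.**  Restricted optima on `J` at slopes `θ₁ < θ₂` (same image of `J`) that differ on `J` have strictly
increasing `J`-slope. [folklore: convexity of the upper envelope] -/
theorem sl_lt_of_inOpt {J : Finset (Fin m)} {θ₁ θ₂ : ℤ} {p₁ p₂ : Equiv.Perm (Fin m) × (Fin m → Fin K)}
    (h1 : InOpt d v ε J θ₁ p₁) (h2 : InOpt d v ε J θ₂ p₂) (himg : J.image p₁.1 = J.image p₂.1) (hθ : θ₁ < θ₂)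
    (hne : restr J p₁ ≠ restr J p₂) : sl d J p₁ < sl d J p₂ := by
  have a := inW_lt_of_inOpt h1 h2.1 himg hne
  have b := inW_lt_of_inOpt h2 h1.1 himg.symm (Ne.symm hne)
  unfold inW at a b
  by_contra hcon
  push Not at hcon
  nlinarith [mul_nonneg (sub_nonneg.2 hθ.le) (sub_nonneg.2 hcon)]

/-- two restricted optima on `J` at the SAME slope (same image of `J`) coincide on `J`. [folklore] -/
theorem restr_eq_of_inOpt {J : Finset (Fin m)} {θ : ℤ} {p₁ p₂ : Equiv.Perm (Fin m) × (Fin m → Fin K)}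
    (h1 : InOpt d v ε J θ p₁) (h2 : InOpt d v ε J θ p₂) (himg : J.image p₁.1 = J.image p₂.1) :
    restr J p₁ = restr J p₂ := by
  by_contra hne
  have a := inW_lt_of_inOpt h1 h2.1 himg hne
  have b := inW_lt_of_inOpt h2 h1.1 himg.symm (Ne.symm hne)
  exact lt_asymm a b

/-- weak form: restricted optima at slopes `θ₁ ≤ θ₂` have weakly increasing `J`-slope. [folklore] -/
theorem sl_le_of_inOpt {J : Finset (Fin m)} {θ₁ θ₂ : ℤ} {p₁ p₂ : Equiv.Perm (Fin m) × (Fin m → Fin K)}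
    (h1 : InOpt d v ε J θ₁ p₁) (h2 : InOpt d v ε J θ₂ p₂) (himg : J.image p₁.1 = J.image p₂.1) (hθ : θ₁ ≤ θ₂) :
    sl d J p₁ ≤ sl d J p₂ := by
  by_cases hr : restr J p₁ = restr J p₂
  · exact (sl_congr (d := d) hr).le
  rcases hθ.lt_or_eq with hlt | heq
  · exact (sl_lt_of_inOpt h1 h2 himg hlt hr).le
  · subst heq
    exact absurd (restr_eq_of_inOpt h1 h2 himg) hr

/-! ## 4. Chains in `ℤ × ℤ` and sub-additivity -/

/-- **A chain inside `A × B` has at most `#A + #B` elements** (rank-sum injection). [folklore] -/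
theorem card_chain_le (A B : Finset ℤ) (Y : Finset (ℤ × ℤ)) (hA : ∀ y ∈ Y, y.1 ∈ A) (hB : ∀ y ∈ Y, y.2 ∈ B)
    (hch : ∀ y ∈ Y, ∀ y' ∈ Y, y ≠ y' → (y.1 ≤ y'.1 ∧ y.2 ≤ y'.2) ∨ (y'.1 ≤ y.1 ∧ y'.2 ≤ y.2)) :
    Y.card ≤ A.card + B.card := by
  classical
  let ψ : ℤ × ℤ → ℕ := fun y => (A.filter (· < y.1)).card + (B.filter (· < y.2)).card
  have hmono : ∀ y ∈ Y, ∀ y' ∈ Y, y ≠ y' → y.1 ≤ y'.1 → y.2 ≤ y'.2 → ψ y < ψ y' := by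
    intro y hy y' _ hne h1 h2
    have s1 : A.filter (· < y.1) ⊆ A.filter (· < y'.1) := by
      intro a ha
      rw [Finset.mem_filter] at ha ⊢
      exact ⟨ha.1, lt_of_lt_of_le ha.2 h1⟩
    have s2 : B.filter (· < y.2) ⊆ B.filter (· < y'.2) := by
      intro b hb
      rw [Finset.mem_filter] at hb ⊢
      exact ⟨hb.1, lt_of_lt_of_le hb.2 h2⟩
    have hne' : y.1 ≠ y'.1 ∨ y.2 ≠ y'.2 := by
      by_contra h
      push Not at h
      exact hne (Prod.ext h.1 h.2)
    rcases hne' with h | h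
    · have hlt : y.1 < y'.1 := lt_of_le_of_ne h1 h
      have hss : A.filter (· < y.1) ⊂ A.filter (· < y'.1) := by
        refine (Finset.ssubset_iff_of_subset s1).2 ⟨y.1, ?_, ?_⟩
        · rw [Finset.mem_filter]; exact ⟨hA y hy, hlt⟩
        · rw [Finset.mem_filter]; exact fun hh => lt_irrefl _ hh.2
      have c1 := Finset.card_lt_card hss
      have c2 := Finset.card_le_card s2
      simp only [ψ]; omega
    · have hlt : y.2 < y'.2 := lt_of_le_of_ne h2 h
      have hss : B.filter (· < y.2) ⊂ B.filter (· < y'.2) := by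
        refine (Finset.ssubset_iff_of_subset s2).2 ⟨y.2, ?_, ?_⟩
        · rw [Finset.mem_filter]; exact ⟨hB y hy, hlt⟩
        · rw [Finset.mem_filter]; exact fun hh => lt_irrefl _ hh.2
      have c1 := Finset.card_lt_card hss
      have c2 := Finset.card_le_card s1
      simp only [ψ]; omega
  have hinj : Set.InjOn ψ Y := by
    intro y hy y' hy' heq
    by_contra hne
    rcases hch y hy y' hy' hne with ⟨h1, h2⟩ | ⟨h1, h2⟩
    · exact absurd heq (hmono y hy y' hy' hne h1 h2).ne
    · exact absurd heq.symm (hmono y' hy' y hy (Ne.symm hne) h1 h2).ne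
  have hbound : ∀ y ∈ Y, ψ y < A.card + B.card := by
    intro y hy
    have hss : A.filter (· < y.1) ⊂ A := by
      refine (Finset.ssubset_iff_of_subset (Finset.filter_subset _ _)).2 ⟨y.1, hA y hy, ?_⟩
      rw [Finset.mem_filter]; exact fun hh => lt_irrefl _ hh.2
    have c1 := Finset.card_lt_card hss
    have c2 : (B.filter (· < y.2)).card ≤ B.card := Finset.card_le_card (Finset.filter_subset _ _)
    simp only [ψ]; omega
  calc Y.card = (Y.image ψ).card := (Finset.card_image_of_injOn hinj).symm
    _ ≤ (Finset.range (A.card + B.card)).card := by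
        refine Finset.card_le_card fun n hn => ?_
        obtain ⟨y, hy, rfl⟩ := Finset.mem_image.1 hn
        exact Finset.mem_range.2 (hbound y hy)
    _ = A.card + B.card := Finset.card_range _

/-- **Sub-additivity of optimal restrictions under union.**  If `Q ⇒ Q₁ ∧ Q₂` and `Q₁` (resp. `Q₂`) fixes the image
of `J₁` (resp. `J₂`) under the permutation, then `#optRestr (J₁ ∪ J₂) Q ≤ #optRestr J₁ Q₁ + #optRestr J₂ Q₂`: the
restrictions on `J₁ ∪ J₂`, read through their two slopes, form a chain in `ℤ × ℤ`. [folklore] -/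
theorem card_optRestr_union_le {J₁ J₂ : Finset (Fin m)}
    {Q Q₁ Q₂ : Equiv.Perm (Fin m) × (Fin m → Fin K) → Prop} (hQ₁ : ∀ p, Q p → Q₁ p) (hQ₂ : ∀ p, Q p → Q₂ p)
    (himg₁ : ∀ p p', Q₁ p → Q₁ p' → J₁.image p.1 = J₁.image p'.1)
    (himg₂ : ∀ p p', Q₂ p → Q₂ p' → J₂.image p.1 = J₂.image p'.1) :
    (optRestr d v ε (J₁ ∪ J₂) Q).card ≤ (optRestr d v ε J₁ Q₁).card + (optRestr d v ε J₂ Q₂).card := by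
  classical
  set V := optRestr d v ε (J₁ ∪ J₂) Q with hV
  let φ : (Fin m → Option (Fin m × Fin K)) → ℤ × ℤ := fun r => (slr d J₁ r, slr d J₂ r)
  set A := (optRestr d v ε J₁ Q₁).image (slr d J₁) with hAdef
  set B := (optRestr d v ε J₂ Q₂).image (slr d J₂) with hBdef
  have hs₁ : J₁ ⊆ J₁ ∪ J₂ := Finset.subset_union_left
  have hs₂ : J₂ ⊆ J₁ ∪ J₂ := Finset.subset_union_right
  -- the key comparison between two elements of `V`
  have hcmp : ∀ r ∈ V, ∀ r' ∈ V, r ≠ r' →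
      (((φ r).1 ≤ (φ r').1 ∧ (φ r).2 ≤ (φ r').2) ∨ ((φ r').1 ≤ (φ r).1 ∧ (φ r').2 ≤ (φ r).2)) ∧ φ r ≠ φ r' := by
    intro r hr r' hr' hne
    obtain ⟨p, θ, hq, hopt, rfl⟩ := mem_optRestr.1 hr
    obtain ⟨p', θ', hq', hopt', rfl⟩ := mem_optRestr.1 hr'
    have i1 := himg₁ p p' (hQ₁ p hq) (hQ₁ p' hq')
    have i2 := himg₂ p p' (hQ₂ p hq) (hQ₂ p' hq')
    have o1 := inOpt_mono hs₁ hopt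
    have o1' := inOpt_mono hs₁ hopt'
    have o2 := inOpt_mono hs₂ hopt
    have o2' := inOpt_mono hs₂ hopt'
    simp only [φ, slr_restr hs₁, slr_restr hs₂]
    have hdiff : restr J₁ p ≠ restr J₁ p' ∨ restr J₂ p ≠ restr J₂ p' := by
      by_contra h
      push Not at h
      apply hne
      refine restr_eq_iff.2 fun i hi => ?_
      rcases Finset.mem_union.1 hi with hi | hi
      · exact restr_eq_iff.1 h.1 i hi
      · exact restr_eq_iff.1 h.2 i hi
    rcases lt_trichotomy θ θ' with hθ | hθ | hθ
    · refine ⟨Or.inl ⟨sl_le_of_inOpt o1 o1' i1 hθ.le, sl_le_of_inOpt o2 o2' i2 hθ.le⟩, fun h => ?_⟩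
      rw [Prod.mk.injEq] at h
      rcases hdiff with hd | hd
      · exact (sl_lt_of_inOpt o1 o1' i1 hθ hd).ne h.1
      · exact (sl_lt_of_inOpt o2 o2' i2 hθ hd).ne h.2
    · subst hθ
      exfalso
      rcases hdiff with hd | hd
      · exact hd (restr_eq_of_inOpt o1 o1' i1)
      · exact hd (restr_eq_of_inOpt o2 o2' i2)
    · refine ⟨Or.inr ⟨sl_le_of_inOpt o1' o1 i1.symm hθ.le, sl_le_of_inOpt o2' o2 i2.symm hθ.le⟩, fun h => ?_⟩
      rw [Prod.mk.injEq] at h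
      rcases hdiff with hd | hd
      · exact (sl_lt_of_inOpt o1' o1 i1.symm hθ (Ne.symm hd)).ne h.1.symm
      · exact (sl_lt_of_inOpt o2' o2 i2.symm hθ (Ne.symm hd)).ne h.2.symm
  have hinj : Set.InjOn φ V := fun r hr r' hr' h => by
    by_contra hne
    exact (hcmp r hr r' hr' hne).2 h
  have hY : (V.image φ).card = V.card := Finset.card_image_of_injOn hinj
  have hA : ∀ y ∈ V.image φ, y.1 ∈ A := by
    intro y hy
    obtain ⟨r, hr, rfl⟩ := Finset.mem_image.1 hy
    obtain ⟨p, θ, hq, hopt, rfl⟩ := mem_optRestr.1 hr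
    simp only [φ, slr_restr hs₁]
    refine Finset.mem_image.2 ⟨restr J₁ p, mem_optRestr.2 ⟨p, θ, hQ₁ p hq, inOpt_mono hs₁ hopt, rfl⟩, ?_⟩
    exact slr_restr (Finset.Subset.refl _) p
  have hB : ∀ y ∈ V.image φ, y.2 ∈ B := by
    intro y hy
    obtain ⟨r, hr, rfl⟩ := Finset.mem_image.1 hy
    obtain ⟨p, θ, hq, hopt, rfl⟩ := mem_optRestr.1 hr
    simp only [φ, slr_restr hs₂]
    refine Finset.mem_image.2 ⟨restr J₂ p, mem_optRestr.2 ⟨p, θ, hQ₂ p hq, inOpt_mono hs₂ hopt, rfl⟩, ?_⟩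
    exact slr_restr (Finset.Subset.refl _) p
  have hch : ∀ y ∈ V.image φ, ∀ y' ∈ V.image φ, y ≠ y' →
      (y.1 ≤ y'.1 ∧ y.2 ≤ y'.2) ∨ (y'.1 ≤ y.1 ∧ y'.2 ≤ y.2) := by
    intro y hy y' hy' hne
    obtain ⟨r, hr, rfl⟩ := Finset.mem_image.1 hy
    obtain ⟨r', hr', rfl⟩ := Finset.mem_image.1 hy'
    have hrr : r ≠ r' := fun h => hne (by rw [h])
    exact (hcmp r hr r' hr' hrr).1
  rw [← hY]
  calc (V.image φ).card ≤ A.card + B.card := card_chain_le A B _ hA hB hch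
    _ ≤ (optRestr d v ε J₁ Q₁).card + (optRestr d v ε J₂ Q₂).card :=
        Nat.add_le_add Finset.card_image_le Finset.card_image_le

end IntervalOpt

end Summit.ValiantsHypothesis.ValiantsHypothesis.Theorems.KPlusLogSqLaw
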